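import Summits.HodgeConjecture.CorCM.GaloisSplitInvolutionTypes
import HarnessLib

/-!
# `C_p ⋊ D₄` (kernel the Klein four-group, `p ≥ 5`) is BAD: a split involution over `C_p × C₂²` with a size-graded half

COR-CM (cell `pub-hodgecm2`), binder seat b04 (gen 30), count-neutral own lane «Galois-CM-type classification» (which Galois CM
fields `(G, c)` have ALL primitive CM types nondegenerate = GOOD, vs. a primitive degenerate type = BAD).  KERNEL ONLY: theorems;
no definition, no named fact, no `sorry`.  `HC_CM` is neither used nor claimed.

THE GROUP.  `G₀ = C_p ⋊ D₄` with `D₄ = ⟨r, s⟩` (Mathlib `DihedralGroup 4`) acting on `C_p` through `D₄/⟨s, r²⟩ ≅ C₂`: `r` inverts,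
`s` centralises (order `8p`; for `p = 3` this is `SmallGroup(24,8) = C₃ ⋊ D₈`, settled by a table certificate in gen 22
`CorCM/GaloisTwentyFourC3SemidirectD8Degenerate`).  Centre `⟨r²⟩`, so complex conjugation is `c = r²`.  The abelian subgroup
`A = C_p × ⟨s, r²⟩ ≅ ℤ/p × ℤ/2 × ℤ/2` (coordinates `(u, σ, ρ) ↔ u·sᵟ r^{2ρ}`) has index two, and the reflection `x = sr`
(`x² = 1`, `c ∉ ⟨1⟩`: the EASY side) acts on it by `θ(u, σ, ρ) = (−u, σ, ρ + σ)` (`(sr) s (sr)⁻¹ = s r²`).  Neither product theorem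
of gen 30 applies (`A` has no `θ`-fixed `C_n`, `n ≥ 2`, avoiding `c`), and gen 24's real-factor theorem does not either (`C_p` is an
exceptional factor, `D₄ ∋ c` is not normal-with-complement the right way round); so we exhibit the half directly.

THE HALF (graded by fibre sizes over `⟨s, r²⟩`).  `S = {(u, σ, ρ) : ρ = f(u, σ)}` with `f(u, 0) = 𝟙[u = 0]`, `f(u, 1) = 𝟙[u ∈ {0, 1}]`
— a CM half for `c = (0, 0, 1)` whose four fibres over `(σ, ρ)` have sizes `1, p − 1, 2, p − 2`, pairwise distinct once `p ≥ 5`;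
hence (§1, explicit witnesses, `p ≥ 5` used through «`ℤ/p` has a point outside any three given ones») `S` is APERIODIC
(`half_aperiodic`) and `θ`-ASYMMETRIC (`half_asymmetric`).  By `CorCM/GaloisSplitInvolutionTypes.exists_simple_degenerate_of_split_involution`:

THEOREM (§2 **`exists_simple_degenerate_cyclic_semidirect_dihedralFour`**).  `p ≥ 5` prime, `K` Galois CM with
`Gal(K/ℚ) ≅ C_p ⋊ D₄` as above (`φ(r) = (·)⁻¹`, `φ(s) = id`), complex conjugation `r²` ⟹ `K` carries a SIMPLE DEGENERATE abelian
variety of dimension `4p` with CM by `K` (rational `(q,q)` class outside the divisor ring on some power).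

ORDER `8p` AFTER THIS FILE (`p ≥ 5`; the groups of order `8p` with a central involution are `P × C_p` for the five `P` of order
`8`, `C_p ⋊ C₈`, `Dic_p × C₂`, `D_p × C₄`, `D_p × C₂²`, `D_{8p}`, `C_p ⋊ D₄`, and for `p ≡ 1 (4)` also `C_p ⋊₄ C₈`): every `(G, c)` is
BAD in the tree EXCEPT `C_{8p}` (GOOD) and the three ARITHMETIC families `Q₈ × C_p`, `C_p ⋊ C₈` (GOOD iff no `μ₄`-norm pair;
gens 25–30) and `C_p ⋊₄ C₈` (open) — `Dic_p × C₂` and `C_p ⋊ D₄` being gen 30.  The enumeration itself is informal.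

## References

* [Kubota1965] T. Kubota, *On the field extension by complex multiplication*, Trans. AMS 118 (1965), §2, §4 Lemma 2.
* [Shimura1998] G. Shimura, *Abelian Varieties with Complex Multiplication and Modular Functions*, §6.2 Thm. 3, §8.2 Prop. 26.
* [Gordon1999HodgeAVSurvey] B. B. Gordon, *A survey of the Hodge conjecture for abelian varieties*, Thm. 6.4, §9.3.
-/

noncomputable section

open CategoryTheory CategoryTheory.Limits NumberField
open scoped BigOperators

namespace Summit.HodgeConjecture.CorCM.SplitInvolution

open Literature.NumberTheory.ComplexMultiplication
open Literature.AlgebraicGeometry.Motives (AbelianVariety CMType)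
open Literature.AlgebraicGeometry.HodgeTheory
open Literature.AlgebraicGeometry.ComplexMultiplication (IsCMTypeRealisation)
open Literature.AlgebraicGeometry.Pohlmann1968
open Literature.Barriers.HodgeConjecture (divisorClassesSpan)

namespace CyclicSemidirectDihedralFour

/-! ## §1 The size-graded half of `ℤ/p × ℤ/2 × ℤ/2` -/

section Half

variable {p : ℕ} [Fact p.Prime]

/-- `ℤ/p` (`p ≥ 4`) has a point outside any three given ones. [folklore] -/
theorem exists_ne_three (hp : 5 ≤ p) (a b c : ZMod p) : ∃ u : ZMod p, u ≠ a ∧ u ≠ b ∧ u ≠ c := by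
  classical
  have hlt : ({a, b, c} : Finset (ZMod p)).card < (Finset.univ : Finset (ZMod p)).card := by
    rw [Finset.card_univ, ZMod.card]
    exact lt_of_le_of_lt Finset.card_le_three (by omega)
  obtain ⟨u, -, hu⟩ := Finset.exists_mem_notMem_of_card_lt_card hlt
  simp only [Finset.mem_insert, Finset.mem_singleton, not_or] at hu
  exact ⟨u, hu.1, hu.2.1, hu.2.2⟩

variable (S : Finset (Multiplicative (ZMod p) × Multiplicative (ZMod 2 × ZMod 2)))
  (hSmem : ∀ (v : Multiplicative (ZMod p)) (w : Multiplicative (ZMod 2 × ZMod 2)), (v, w) ∈ S ↔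
    ((Multiplicative.toAdd w).2 = if (Multiplicative.toAdd w).1 = 0 then (if Multiplicative.toAdd v = 0 then 1 else 0)
      else (if Multiplicative.toAdd v = 0 ∨ Multiplicative.toAdd v = 1 then 1 else 0)))
include hSmem

/-- The size-graded half `S = {(u, σ, ρ) : ρ = f(u, σ)}`, `f(u, 0) = 𝟙[u = 0]`, `f(u, 1) = 𝟙[u ∈ {0,1}]` (given through its
membership predicate) is a CM half for `c = (0, 0, 1)`. [folklore] -/
theorem half_cm (a : Multiplicative (ZMod p) × Multiplicative (ZMod 2 × ZMod 2)) :
    a ∈ S ↔ ((1 : Multiplicative (ZMod p)), Multiplicative.ofAdd ((0 : ZMod 2), (1 : ZMod 2))) * a ∉ S := by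
  obtain ⟨v, w⟩ := a
  have key : ∀ ρ F : ZMod 2, (ρ = F ↔ ¬ (1 + ρ = F)) := by decide
  rw [Prod.mk_mul_mk, one_mul, hSmem, hSmem, toAdd_mul, toAdd_ofAdd, Prod.snd_add, Prod.fst_add, zero_add]
  exact key _ _

/-- **APERIODIC** (`p ≥ 5`): no `a = (α, β, γ) ≠ 0` translates the half onto itself — the four fibres have the distinct sizes
`1, p − 1, 2, p − 2`; explicit witnesses. [folklore] -/
theorem half_aperiodic (hp : 5 ≤ p) (α : ZMod p) (β γ : ZMod 2) (ha : (α, (β, γ)) ≠ (0 : ZMod p × (ZMod 2 × ZMod 2))) :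
    ∃ s, ¬ (s ∈ S ↔ ((Multiplicative.ofAdd α, Multiplicative.ofAdd (β, γ)) : Multiplicative (ZMod p) ×
      Multiplicative (ZMod 2 × ZMod 2)) * s ∈ S) := by
  haveI : Fact (1 < p) := ⟨by omega⟩
  have z01 : ∀ z : ZMod 2, z = 0 ∨ z = 1 := by decide
  have h10 : (1 : ZMod p) ≠ 0 := one_ne_zero
  -- witness `(u, σ, ρ)`: membership of `s` and of `a s` in coordinates
  have hw : ∀ (u : ZMod p) (σ ρ : ZMod 2),
      (((Multiplicative.ofAdd u, Multiplicative.ofAdd (σ, ρ)) : Multiplicative (ZMod p) × Multiplicative (ZMod 2 × ZMod 2)) ∈ S ↔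
        (ρ = if σ = 0 then (if u = 0 then 1 else 0) else (if u = 0 ∨ u = 1 then 1 else 0))) ∧
      (((Multiplicative.ofAdd α, Multiplicative.ofAdd (β, γ)) : Multiplicative (ZMod p) × Multiplicative (ZMod 2 × ZMod 2)) *
          (Multiplicative.ofAdd u, Multiplicative.ofAdd (σ, ρ)) ∈ S ↔
        (γ + ρ = if β + σ = 0 then (if α + u = 0 then 1 else 0) else (if α + u = 0 ∨ α + u = 1 then 1 else 0))) := by
    intro u σ ρ
    rw [Prod.mk_mul_mk, ← ofAdd_add, ← ofAdd_add, Prod.mk_add_mk, hSmem, hSmem, toAdd_ofAdd, toAdd_ofAdd, toAdd_ofAdd,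
      toAdd_ofAdd]
    exact ⟨Iff.rfl, Iff.rfl⟩
  rcases z01 β with rfl | rfl <;> rcases z01 γ with rfl | rfl
  · -- `(β, γ) = (0, 0)`: `α ≠ 0`; witness `(0, 0, 1)`
    have hα : α ≠ 0 := fun h => ha (by rw [h]; rfl)
    refine ⟨(Multiplicative.ofAdd 0, Multiplicative.ofAdd (0, 1)), ?_⟩
    rw [(hw 0 0 1).1, (hw 0 0 1).2]
    simp [hα]
  · -- `(0, 1)`: `u ∉ {0, −α}`, witness `(u, 0, 0)`
    obtain ⟨u, hu0, huα, -⟩ := exists_ne_three hp 0 (-α) 0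
    have hαu : α + u ≠ 0 := fun h => huα (by linear_combination h)
    refine ⟨(Multiplicative.ofAdd u, Multiplicative.ofAdd (0, 0)), ?_⟩
    rw [(hw u 0 0).1, (hw u 0 0).2]
    simp [hu0, hαu]
  · -- `(1, 0)`: witness `(1, 0, 0)` if `α = 0`, `(−α, 0, 0)` otherwise
    by_cases hα : α = 0
    · subst hα
      refine ⟨(Multiplicative.ofAdd 1, Multiplicative.ofAdd (0, 0)), ?_⟩
      rw [(hw 1 0 0).1, (hw 1 0 0).2]
      simp [h10]
    · refine ⟨(Multiplicative.ofAdd (-α), Multiplicative.ofAdd (0, 0)), ?_⟩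
      rw [(hw (-α) 0 0).1, (hw (-α) 0 0).2]
      simp [hα]
  · -- `(1, 1)`: `u ∉ {0, −α, 1 − α}`, witness `(u, 0, 0)`
    obtain ⟨u, hu0, huα, huα'⟩ := exists_ne_three hp 0 (-α) (1 - α)
    have hαu : α + u ≠ 0 := fun h => huα (by linear_combination h)
    have hαu' : α + u ≠ 1 := fun h => huα' (by linear_combination h)
    refine ⟨(Multiplicative.ofAdd u, Multiplicative.ofAdd (0, 0)), ?_⟩
    rw [(hw u 0 0).1, (hw u 0 0).2]
    simp [hu0, hαu, hαu']

/-- **`θ`-ASYMMETRIC** (`p ≥ 5`) for `θ(u, σ, ρ) = (−u, σ, ρ + σ)`: no `a` has `a·θ(S) = S`; explicit witnesses. [folklore] -/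
theorem half_asymmetric (hp : 5 ≤ p) (α : ZMod p) (β γ : ZMod 2) :
    ∃ s : Multiplicative (ZMod p) × Multiplicative (ZMod 2 × ZMod 2),
      ¬ (s ∈ S ↔ ((Multiplicative.ofAdd α, Multiplicative.ofAdd (β, γ)) : Multiplicative (ZMod p) ×
        Multiplicative (ZMod 2 × ZMod 2)) * (s.1⁻¹, Multiplicative.ofAdd ((Multiplicative.toAdd s.2).1,
          (Multiplicative.toAdd s.2).2 + (Multiplicative.toAdd s.2).1)) ∈ S) := by
  haveI : Fact (1 < p) := ⟨by omega⟩
  have z01 : ∀ z : ZMod 2, z = 0 ∨ z = 1 := by decide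
  have h10 : (1 : ZMod p) ≠ 0 := one_ne_zero
  have hm10 : (-1 : ZMod p) ≠ 0 := neg_ne_zero.2 h10
  have hw : ∀ (u : ZMod p) (σ ρ : ZMod 2),
      (((Multiplicative.ofAdd u, Multiplicative.ofAdd (σ, ρ)) : Multiplicative (ZMod p) × Multiplicative (ZMod 2 × ZMod 2)) ∈ S ↔
        (ρ = if σ = 0 then (if u = 0 then 1 else 0) else (if u = 0 ∨ u = 1 then 1 else 0))) ∧
      (((Multiplicative.ofAdd α, Multiplicative.ofAdd (β, γ)) : Multiplicative (ZMod p) × Multiplicative (ZMod 2 × ZMod 2)) *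
          ((Multiplicative.ofAdd u)⁻¹, Multiplicative.ofAdd ((Multiplicative.toAdd (Multiplicative.ofAdd (σ, ρ))).1,
            (Multiplicative.toAdd (Multiplicative.ofAdd (σ, ρ))).2 + (Multiplicative.toAdd (Multiplicative.ofAdd (σ, ρ))).1)) ∈ S ↔
        (γ + (ρ + σ) = if β + σ = 0 then (if α + -u = 0 then 1 else 0) else (if α + -u = 0 ∨ α + -u = 1 then 1 else 0))) := by
    intro u σ ρ
    rw [toAdd_ofAdd, ← ofAdd_neg, Prod.mk_mul_mk, ← ofAdd_add, ← ofAdd_add, Prod.mk_add_mk, hSmem, hSmem, toAdd_ofAdd,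
      toAdd_ofAdd, toAdd_ofAdd, toAdd_ofAdd]
    exact ⟨Iff.rfl, Iff.rfl⟩
  rcases z01 β with rfl | rfl <;> rcases z01 γ with rfl | rfl
  · -- `(0, 0)`: witness `(0, 0, 1)` if `α ≠ 0`, `(0, 1, 1)` if `α = 0`
    by_cases hα : α = 0
    · subst hα
      refine ⟨(Multiplicative.ofAdd 0, Multiplicative.ofAdd (1, 1)), ?_⟩
      rw [(hw 0 1 1).1, (hw 0 1 1).2]
      simp
    · refine ⟨(Multiplicative.ofAdd 0, Multiplicative.ofAdd (0, 1)), ?_⟩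
      rw [(hw 0 0 1).1, (hw 0 0 1).2]
      simp [hα]
  · -- `(0, 1)`: `u ∉ {0, α}`, witness `(u, 0, 0)`
    obtain ⟨u, hu0, huα, -⟩ := exists_ne_three hp 0 α 0
    have hαu : α + -u ≠ 0 := fun h => huα (by linear_combination -h)
    refine ⟨(Multiplicative.ofAdd u, Multiplicative.ofAdd (0, 0)), ?_⟩
    rw [(hw u 0 0).1, (hw u 0 0).2]
    simp [hu0, hαu]
  · -- `(1, 0)`: `α = 0`: `(−1, 0, 0)`; `α = 1`: `(1, 0, 0)`; else `(0, 0, 1)`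
    by_cases hα : α = 0
    · subst hα
      refine ⟨(Multiplicative.ofAdd (-1), Multiplicative.ofAdd (0, 0)), ?_⟩
      rw [(hw (-1) 0 0).1, (hw (-1) 0 0).2]
      simp [hm10, h10]
    · by_cases hα1 : α = 1
      · subst hα1
        refine ⟨(Multiplicative.ofAdd 1, Multiplicative.ofAdd (0, 0)), ?_⟩
        rw [(hw 1 0 0).1, (hw 1 0 0).2]
        simp [h10]
      · refine ⟨(Multiplicative.ofAdd 0, Multiplicative.ofAdd (0, 1)), ?_⟩
        rw [(hw 0 0 1).1, (hw 0 0 1).2]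
        simp [hα, hα1]
  · -- `(1, 1)`: `u ∉ {0, α, α − 1}`, witness `(u, 0, 0)`
    obtain ⟨u, hu0, huα, huα'⟩ := exists_ne_three hp 0 α (α - 1)
    have hαu : α + -u ≠ 0 := fun h => huα (by linear_combination -h)
    have hαu' : α + -u ≠ 1 := fun h => huα' (by linear_combination -h)
    refine ⟨(Multiplicative.ofAdd u, Multiplicative.ofAdd (0, 0)), ?_⟩
    rw [(hw u 0 0).1, (hw u 0 0).2]
    simp [hu0, hαu, hαu']

end Half

end CyclicSemidirectDihedralFour

/-! ## §2 `C_p ⋊ D₄` is BAD -/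

section Field

open CyclicSemidirectDihedralFour

variable {p : ℕ} [Fact p.Prime]
variable {K : Type} [Field K] [NumberField K] [IsCMField K] [IsGalois ℚ K]

/-- **`Gal(K/ℚ) ≅ C_p ⋊ D₄` (`p ≥ 5`, `r` inverting `C_p`, `s` centralising it, complex conjugation `r²`) is BAD**: `K` carries a
SIMPLE DEGENERATE abelian variety of dimension `4p` with CM by `K` (rational `(q,q)` class outside the divisor ring on some power) —
the doubled type of the size-graded half of `A = C_p × ⟨s, r²⟩` under the reflection `sr`.
[cite: Kubota1965, §2 and §4 Lemma 2] [cite: Shimura1998, §6.2 Thm. 3 and §8.2 Prop. 26] [cite: Gordon1999HodgeAVSurvey, Thm. 6.4 and §9.3] -/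
theorem exists_simple_degenerate_cyclic_semidirect_dihedralFour (hp5 : 5 ≤ p)
    (φ : DihedralGroup 4 →* MulAut (Multiplicative (ZMod p)))
    (hr : ∀ v : Multiplicative (ZMod p), φ (DihedralGroup.r 1) v = v⁻¹)
    (hs : ∀ v : Multiplicative (ZMod p), φ (DihedralGroup.sr 0) v = v)
    (e : (K ≃ₐ[ℚ] K) ≃* Multiplicative (ZMod p) ⋊[φ] DihedralGroup 4)
    (hc : e ((IsCMField.complexConj K).restrictScalars ℚ) = SemidirectProduct.inr (DihedralGroup.r 2)) :
    ∃ (Φ : CMType K) (φ₀ : K →+* ℂ) (X : AbelianVariety ℂ) (ι : 𝓞 K →+* End X)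
      (ϑ : K →+* Module.End ℂ (complexBetti X.X 1)),
      IsPrimitive (ℂ ≃+* ℂ) Φ.1 φ₀ ∧ ¬ IsNondegenerate Φ ∧ IsCMTypeRealisation Φ X ι ϑ ∧ X.IsSimple ∧ X.dim = 4 * p ∧
      ∃ n q : ℕ, ∃ y : complexBetti (⨁ fun _ : Fin n => X).X (2 * q), IsRationalClass y ∧
        IsOfHodgeType (⨁ fun _ : Fin n => X).dim (⨁ fun _ : Fin n => X).X (2 * q) q q y ∧
        y ∉ divisorClassesSpan (⨁ fun _ : Fin n => X).X (⨁ fun _ : Fin n => X).dim q := by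
  classical
  have hp : p.Prime := Fact.out
  haveI : NeZero p := ⟨hp.ne_zero⟩
  haveI : Fintype (Multiplicative (ZMod p) ⋊[φ] DihedralGroup 4) := Fintype.ofEquiv _ SemidirectProduct.equivProd.symm
  have hcard : Fintype.card (Multiplicative (ZMod p) ⋊[φ] DihedralGroup 4) = 8 * p := by
    rw [Fintype.card_congr SemidirectProduct.equivProd, Fintype.card_prod, Fintype.card_multiplicative, ZMod.card,
      DihedralGroup.card]; ring
  -- the Klein four-group `⟨s, r²⟩ ⊂ D₄` parametrised by `ℤ/2 × ℤ/2`
  let d : ZMod 2 × ZMod 2 → DihedralGroup 4 := fun w =>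
    if w.1 = 0 then DihedralGroup.r (2 * (w.2.val : ZMod 4)) else DihedralGroup.sr (2 * (w.2.val : ZMod 4))
  let ψ : ZMod 2 × ZMod 2 → ZMod 2 × ZMod 2 := fun w => (w.1, w.2 + w.1)
  have hd_mul : ∀ w w', d (w + w') = d w * d w' := by decide
  have hd_ne : ∀ w, d w ≠ DihedralGroup.sr 1 := by decide
  have hd_cov : ∀ δ : DihedralGroup 4, (∃ w, δ = d w) ∨ (∃ w, δ = d w * DihedralGroup.sr 1) := by decide
  have hd_conj : ∀ w, DihedralGroup.sr 1 * d w = d (ψ w) * DihedralGroup.sr 1 := by decide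
  have hd_inj : ∀ w w', d w = d w' → w = w' := by decide
  have hd_cases : ∀ w, d w = DihedralGroup.r 0 ∨ d w = DihedralGroup.r 2 ∨ d w = DihedralGroup.sr 0 ∨
      d w = DihedralGroup.sr 2 := by decide
  have hd01 : d (0, 1) = DihedralGroup.r 2 := by decide
  have hψ_add : ∀ a b, ψ (a + b) = ψ a + ψ b := by decide
  have hψ_inv : ∀ a, ψ (ψ a) = a := by decide
  -- the action on the Klein four-group is trivial, and `φ(sr) = (·)⁻¹`
  have hr2 : ∀ v, φ (DihedralGroup.r 2) v = v := fun v => by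
    rw [show (DihedralGroup.r 2 : DihedralGroup 4) = DihedralGroup.r 1 * DihedralGroup.r 1 by decide, map_mul,
      MulAut.mul_apply, hr, hr, inv_inv]
  have hφd : ∀ w v, φ (d w) v = v := by
    intro w v
    rcases hd_cases w with h | h | h | h <;> rw [h]
    · rw [← DihedralGroup.one_def, map_one, MulAut.one_apply]
    · exact hr2 v
    · exact hs v
    · rw [show (DihedralGroup.sr 2 : DihedralGroup 4) = DihedralGroup.sr 0 * DihedralGroup.r 2 by decide, map_mul,
        MulAut.mul_apply, hr2, hs]
  have hφx : ∀ v, φ (DihedralGroup.sr 1) v = v⁻¹ := fun v => by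
    rw [show (DihedralGroup.sr 1 : DihedralGroup 4) = DihedralGroup.sr 0 * DihedralGroup.r 1 by decide, map_mul,
      MulAut.mul_apply, hr, hs]
  -- the embedding of `A = C_p × C₂²`
  let i : Multiplicative (ZMod p) × Multiplicative (ZMod 2 × ZMod 2) →* Multiplicative (ZMod p) ⋊[φ] DihedralGroup 4 :=
    MonoidHom.mk' (fun w => ⟨w.1, d (Multiplicative.toAdd w.2)⟩) fun w w' => by
      refine SemidirectProduct.ext ?_ ?_
      · simp only [SemidirectProduct.mul_left, Prod.fst_mul, hφd]
      · simp only [SemidirectProduct.mul_right, Prod.snd_mul, toAdd_mul, hd_mul]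
  have hi_apply : ∀ w, i w = ⟨w.1, d (Multiplicative.toAdd w.2)⟩ := fun w => rfl
  have hi : Function.Injective i := by
    rintro ⟨v, w⟩ ⟨v', w'⟩ h
    rw [hi_apply, hi_apply, SemidirectProduct.ext_iff] at h
    exact Prod.ext h.1 (Multiplicative.toAdd.injective (hd_inj _ _ h.2))
  set x : Multiplicative (ZMod p) ⋊[φ] DihedralGroup 4 := ⟨1, DihedralGroup.sr 1⟩ with hx_def
  have hx : ∀ w, i w ≠ x := fun w h => by
    rw [hi_apply, hx_def, SemidirectProduct.ext_iff] at h
    exact hd_ne _ h.2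
  have hcov : ∀ g : Multiplicative (ZMod p) ⋊[φ] DihedralGroup 4, (∃ w, g = i w) ∨ (∃ w, g = i w * x) := by
    rintro ⟨v, δ⟩
    rcases hd_cov δ with ⟨w, hw⟩ | ⟨w, hw⟩
    · refine Or.inl ⟨(v, Multiplicative.ofAdd w), ?_⟩
      rw [hi_apply, toAdd_ofAdd, hw]
    · refine Or.inr ⟨(v, Multiplicative.ofAdd w), ?_⟩
      rw [hi_apply, toAdd_ofAdd, hx_def, SemidirectProduct.mul_def]
      refine SemidirectProduct.ext ?_ ?_
      · simp
      · simpa using hw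
  let ψe : ZMod 2 × ZMod 2 ≃+ ZMod 2 × ZMod 2 :=
    { toFun := ψ, invFun := ψ, left_inv := hψ_inv, right_inv := hψ_inv, map_add' := hψ_add }
  let θ : Multiplicative (ZMod p) × Multiplicative (ZMod 2 × ZMod 2) ≃*
      Multiplicative (ZMod p) × Multiplicative (ZMod 2 × ZMod 2) :=
    MulEquiv.prodCongr (MulEquiv.inv _) ψe.toMultiplicative
  have hθ_apply : ∀ w, θ w = (w.1⁻¹, Multiplicative.ofAdd ((Multiplicative.toAdd w.2).1,
      (Multiplicative.toAdd w.2).2 + (Multiplicative.toAdd w.2).1)) := fun w => rfl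
  have hθ : ∀ w, x * i w = i (θ w) * x := fun ⟨v, w⟩ => by
    rw [hi_apply, hi_apply, hθ_apply, hx_def, SemidirectProduct.mul_def, SemidirectProduct.mul_def]
    refine SemidirectProduct.ext ?_ ?_
    · simp [hφx, hφd]
    · simpa using hd_conj (Multiplicative.toAdd w)
  have hxx : x * x = 1 := by
    rw [hx_def, SemidirectProduct.mul_def]
    refine SemidirectProduct.ext ?_ ?_
    · simp
    · simp only [SemidirectProduct.one_right]
      decide
  set c : Multiplicative (ZMod p) × Multiplicative (ZMod 2 × ZMod 2) := (1, Multiplicative.ofAdd (0, 1)) with hc_def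
  have hic : i c = SemidirectProduct.inr (DihedralGroup.r 2) := by
    rw [hi_apply, hc_def, toAdd_ofAdd, hd01]; rfl
  have hc1 : c ≠ 1 := by
    rw [hc_def, Ne, Prod.mk_eq_one, not_and_or]
    exact Or.inr (by decide)
  have hcc : c * c = 1 := by
    rw [hc_def, Prod.mk_mul_mk, mul_one]
    exact Prod.ext rfl (show Multiplicative.ofAdd ((0 : ZMod 2), (1 : ZMod 2)) * Multiplicative.ofAdd ((0 : ZMod 2), (1 : ZMod 2))
      = 1 by decide)
  have hθc : θ c = c := by
    rw [hθ_apply, hc_def, inv_one]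
    exact Prod.ext rfl (show Multiplicative.ofAdd (ψ (Multiplicative.toAdd (Multiplicative.ofAdd ((0 : ZMod 2), (1 : ZMod 2)))))
      = Multiplicative.ofAdd ((0 : ZMod 2), (1 : ZMod 2)) by decide)
  -- the half
  set S : Finset (Multiplicative (ZMod p) × Multiplicative (ZMod 2 × ZMod 2)) := Finset.univ.filter fun w =>
    (Multiplicative.toAdd w.2).2 = if (Multiplicative.toAdd w.2).1 = 0 then
      (if Multiplicative.toAdd w.1 = 0 then 1 else 0)
      else (if Multiplicative.toAdd w.1 = 0 ∨ Multiplicative.toAdd w.1 = 1 then 1 else 0) with hS_def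
  have hSmem : ∀ (v : Multiplicative (ZMod p)) (w : Multiplicative (ZMod 2 × ZMod 2)), (v, w) ∈ S ↔
      ((Multiplicative.toAdd w).2 = if (Multiplicative.toAdd w).1 = 0 then (if Multiplicative.toAdd v = 0 then 1 else 0)
        else (if Multiplicative.toAdd v = 0 ∨ Multiplicative.toAdd v = 1 then 1 else 0)) := fun v w => by
    simp only [hS_def, Finset.mem_filter, Finset.mem_univ, true_and]
  have hS : ∀ a, a ∈ S ↔ c * a ∉ S := fun a => by rw [hc_def]; exact half_cm S hSmem a
  have haper : ∀ a : Multiplicative (ZMod p) × Multiplicative (ZMod 2 × ZMod 2), a ≠ 1 → ∃ s, ¬ (s ∈ S ↔ a * s ∈ S) := by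
    rintro ⟨av, aw⟩ ha
    have ha' : (Multiplicative.toAdd av, ((Multiplicative.toAdd aw).1, (Multiplicative.toAdd aw).2)) ≠
        (0 : ZMod p × (ZMod 2 × ZMod 2)) := by
      intro h
      apply ha
      rw [Prod.mk.eta, Prod.mk_eq_zero] at h
      exact Prod.ext (toAdd_eq_zero.1 h.1) (toAdd_eq_zero.1 h.2)
    have e1 : ((av, aw) : Multiplicative (ZMod p) × Multiplicative (ZMod 2 × ZMod 2)) =
        (Multiplicative.ofAdd (Multiplicative.toAdd av),
          Multiplicative.ofAdd ((Multiplicative.toAdd aw).1, (Multiplicative.toAdd aw).2)) := by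
      rw [Prod.mk.eta, ofAdd_toAdd, ofAdd_toAdd]
    rw [e1]
    exact half_aperiodic S hSmem hp5 _ _ _ ha'
  have hasym : ∀ a : Multiplicative (ZMod p) × Multiplicative (ZMod 2 × ZMod 2), ∃ s, ¬ (s ∈ S ↔ a * θ s ∈ S) := by
    rintro ⟨av, aw⟩
    have e1 : ((av, aw) : Multiplicative (ZMod p) × Multiplicative (ZMod 2 × ZMod 2)) =
        (Multiplicative.ofAdd (Multiplicative.toAdd av),
          Multiplicative.ofAdd ((Multiplicative.toAdd aw).1, (Multiplicative.toAdd aw).2)) := by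
      rw [Prod.mk.eta, ofAdd_toAdd, ofAdd_toAdd]
    obtain ⟨s, hs⟩ := half_asymmetric S hSmem hp5 (Multiplicative.toAdd av) (Multiplicative.toAdd aw).1
      (Multiplicative.toAdd aw).2
    refine ⟨s, ?_⟩
    rw [hθ_apply, e1]
    exact hs
  obtain ⟨Φ, φ₀, X, ι, ϑ, h1, h2, h3, h4, h5, h6⟩ := exists_simple_degenerate_of_split_involution e i hi x hx hcov θ hθ hxx hc1
    hcc hθc (by rw [hic]; exact hc) S hS haper hasym
  refine ⟨Φ, φ₀, X, ι, ϑ, h1, h2, h3, h4, ?_, h6⟩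
  rw [h5, hcard]
  omega

end Field

end Summit.HodgeConjecture.CorCM.SplitInvolution

end
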